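import Literature.NumberTheory.EllipticCurves.Rank1Residual.CyclotomicWindingSpan
import Mathlib.LinearAlgebra.Matrix.FixedDetMatrices
import HarnessLib

/-!
# Route `PrintX8`, crux 20622 `MuBoundSmallImageX8` — LINE «vertical Stevens at 3»:
# THEOREM (T) in the kernel — at prime level the `p`-power winding classes span `H₁(X₀(N);ℤ)`

Cell `bsd-print-x8`, seat p1 (gen 4), `--supports stmt-BirchSwinnertonDyer-20622`.  Theorems only (no
definitions, no named facts); everything is over ty2's carrier file
`Literature/NumberTheory/EllipticCurves/Rank1Residual/CyclotomicWindingSpan.lean` (p557383: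
`spanGenerators`, `spanSubgroup`, `InGammaH`, `ConjSpanGen`, `EisSpanGen`) and Mathlib
(`SpecialLinearGroup.SL2Z_generators`: `SL(2,ℤ) = ⟨S, T⟩`).

## THEOREM (T) (bsd-f3-mu MEMO-an §10.2; cell memo `plan/vs/LINE-VERTICAL-STEVENS-AT-3.md` §3)

For a PRIME level `N` and any `p` such that every unit of `ℤ/N` is `± pᵏ` (hypothesis (H_T), in the
spelling of `Rank1Residual.conjSpanGen_iff_top_of_forall_isUnit`), the good elements (`|d| = pᵐ`), the
finite-order elements and the trace-`±2` elements GENERATE `Γ₀(N)` outright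
(`closure_spanGenerators_eq_top`); hence `spanSubgroup N p = ⊤`, `ConjSpanGen N p` and `EisSpanGen N p`
(`conjSpanGen_of_prime`, `eisSpanGen_of_prime`).  Through Manin 1972 Prop. 1.4 this is
«`V(N,p) = H₁(X₀(N);ℤ)`»: at such levels EVERY closed class on `X₀(N)` is an integral combination of the
`p`-power winding classes `{0 → a/pᵐ}`.  First certified instance: `ConjSpanGen 11 3`
(`(ℤ/11)ˣ = ⟨−1, 3⟩`; kit j286420's line `N=11 p=3 l=3 … [FULL]` is now a theorem).

Proof (a transversal-free form of the memo's Schreier argument).  Let `K ≤ SL(2,ℤ)` be the image of the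
closure and call `A ∈ SL(2,ℤ)` REACHED if `A ∈ K` or `A = k·S·Tʲ` with `k ∈ K`, `j ∈ ℤ`.  The reached set
contains `1` and is stable under right multiplication by `T^{±1}` (`T ∈ K`, `S Tʲ T^{e} = S T^{j+e}`) and
by `S`: if `N ∣ j` then `S Tʲ S = (1 0; −j 1)·(−I) ∈ K`; if `N ∤ j` then `−j⁻¹ ≡ ε pᵏ (mod N)` by (H_T)
(`N` prime), and with the INTEGER `j' := ε pᵏ` one has `S Tʲ S = g · S T^{j'}` for
`g = (−j', −1; jj'+1, j) ∈ Γ₀(N)`, whose inverse `(j, 1; −jj'−1, −j')` has `d`-entry `−j' = ∓pᵏ`, so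
`g⁻¹` is good and `g ∈ K`.  As `S⁻¹ = S³` and `SL(2,ℤ) = ⟨S, T⟩`, every matrix is reached; a reached
element of `Γ₀(N)` of the second shape would put `S Tʲ = (0 −1; 1 j)` in `Γ₀(N)`, i.e. `N ∣ 1`.  So
`Γ₀(N) ⊆ K`.  No use is made of `p` prime, `p ∤ N` or `p` odd (for `N ≥ 5` they follow from (H_T)).

What is NOT here: composite levels (CONJ-SPAN / EIS-SPAN for general `N`, where `Γ_H(N) ≠ Γ₀(N)` and a
transversal adapted to the `⟨±p⟩`-cosets would be needed) — that is the open VS-0 of the line.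
-/

-- the summit namespace repeats `BirchSwinnertonDyer` by design (summit = problem); linter moot
set_option linter.dupNamespace false
set_option autoImplicit false

namespace Summit.BirchSwinnertonDyer.BirchSwinnertonDyer.Theorems.PrintX8VerticalStevens

open scoped MatrixGroups

open CongruenceSubgroup Matrix Matrix.SpecialLinearGroup ModularGroup
  Literature.NumberTheory.EllipticCurves.Rank1Residual

section TheoremT

variable {N : ℕ} (p : ℕ)

/-- An element of `Γ₀(N)` lying in the closure of the span generators has its underlying matrix in the
image `K ≤ SL(2,ℤ)` of that closure. -/
theorem coe_mem_map_closure {γ : Gamma0 N} (h : γ ∈ Subgroup.closure (spanGenerators N p)) :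
    (γ : SL(2, ℤ)) ∈ (Subgroup.closure (spanGenerators N p)).map (Gamma0 N).subtype :=
  ⟨γ, h, rfl⟩

/-- Conversely, membership of the underlying matrix in the image `K` gives membership in the closure. -/
theorem mem_closure_of_coe_mem_map {γ : Gamma0 N}
    (h : (γ : SL(2, ℤ)) ∈ (Subgroup.closure (spanGenerators N p)).map (Gamma0 N).subtype) :
    γ ∈ Subgroup.closure (spanGenerators N p) := by
  obtain ⟨δ, hδ, hδγ⟩ := h
  have : δ = γ := Subtype.ext hδγ
  exact this ▸ hδ

/-- Every element of the image `K` lies in `Γ₀(N)`. -/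
theorem mem_gamma0_of_mem_map {x : SL(2, ℤ)}
    (h : x ∈ (Subgroup.closure (spanGenerators N p)).map (Gamma0 N).subtype) : x ∈ Gamma0 N := by
  obtain ⟨δ, _, rfl⟩ := h
  exact δ.2

/-- `T = (1 1; 0 1) ∈ K`: it lies in `Γ₀(N)` and is good (`d = 1 = p⁰`). -/
theorem T_mem_map_closure :
    (T : SL(2, ℤ)) ∈ (Subgroup.closure (spanGenerators N p)).map (Gamma0 N).subtype := by
  have hT : (T : SL(2, ℤ)) ∈ Gamma0 N := by simp [Gamma0_mem, coe_T]
  refine coe_mem_map_closure p (γ := ⟨T, hT⟩) (Subgroup.subset_closure ?_)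
  exact mem_spanGenerators_of_isGoodAt (isGoodAt_of_natAbs_dEntry_eq_one p (by simp [dEntry, coe_T]))

/-- `−I ∈ K` (trace `−2`). -/
theorem neg_one_mem_map_closure :
    (-1 : SL(2, ℤ)) ∈ (Subgroup.closure (spanGenerators N p)).map (Gamma0 N).subtype :=
  coe_mem_map_closure p (Subgroup.subset_closure (negOneGamma0_mem_spanGenerators N p))

/-- For `N ∣ j`: `S Tʲ S = (1 0; −j 1) · (−I) ∈ K` (the lower unipotent is in `Γ₀(N)` and good, `d = 1`). -/
theorem S_mul_T_zpow_mul_S_mem_of_dvd {j : ℤ} (hj : ((j : ℤ) : ZMod N) = 0) :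
    S * T ^ j * S ∈ (Subgroup.closure (spanGenerators N p)).map (Gamma0 N).subtype := by
  have hdet : Matrix.det !![(1 : ℤ), 0; -j, 1] = 1 := by simp [Matrix.det_fin_two_of]
  have hj' : ((-j : ℤ) : ZMod N) = 0 := by rw [Int.cast_neg, hj, neg_zero]
  have hmem : (⟨!![(1 : ℤ), 0; -j, 1], hdet⟩ : SL(2, ℤ)) ∈ Gamma0 N :=
    Gamma0_mem.mpr (by simpa using hj')
  set L : Gamma0 N := ⟨⟨!![(1 : ℤ), 0; -j, 1], hdet⟩, hmem⟩ with hL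
  have hLgood : L ∈ spanGenerators N p :=
    mem_spanGenerators_of_isGoodAt (isGoodAt_of_natAbs_dEntry_eq_one p (by simp [dEntry, hL]))
  have hprod : S * T ^ j * S = (L : SL(2, ℤ)) * (-1 : SL(2, ℤ)) := by
    ext i j'
    fin_cases i <;> fin_cases j' <;>
      simp [coe_mul, coe_S, coe_T_zpow, hL, Matrix.mul_apply, Fin.sum_univ_two]
  rw [hprod]
  exact Subgroup.mul_mem _ (coe_mem_map_closure p (Subgroup.subset_closure hLgood))
    (neg_one_mem_map_closure p)

/-- The Schreier step: if `N ∣ jj' + 1` and `|j'| = pᵏ`, then `S Tʲ S = g · (S T^{j'})` with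
`g = (−j', −1; jj'+1, j) ∈ Γ₀(N)` lying in the closure — its inverse `(j, 1; −jj'−1, −j')` is good. -/
theorem exists_S_mul_T_zpow_mul_S_eq_of_rel (j j' : ℤ) (h : ((j * j' + 1 : ℤ) : ZMod N) = 0) {k : ℕ}
    (hk : j'.natAbs = p ^ k) :
    ∃ g ∈ (Subgroup.closure (spanGenerators N p)).map (Gamma0 N).subtype,
      S * T ^ j * S = g * (S * T ^ j') := by
  have hdet : Matrix.det !![-j', -1; j * j' + 1, j] = 1 := by rw [Matrix.det_fin_two_of]; ring
  have hmem : (⟨!![-j', -1; j * j' + 1, j], hdet⟩ : SL(2, ℤ)) ∈ Gamma0 N :=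
    Gamma0_mem.mpr (by simpa using h)
  set g : Gamma0 N := ⟨⟨!![-j', -1; j * j' + 1, j], hdet⟩, hmem⟩ with hg
  have hginv : g⁻¹ ∈ spanGenerators N p := by
    apply mem_spanGenerators_of_isGoodAt
    refine ⟨k, ?_⟩
    have : dEntry g⁻¹ = -j' := by
      simp [dEntry, hg, coe_inv, Matrix.adjugate_fin_two_of]
    rw [this, Int.natAbs_neg, hk]
  have hgmem : g ∈ Subgroup.closure (spanGenerators N p) := by
    rw [← inv_mem_iff]
    exact Subgroup.subset_closure hginv
  refine ⟨g, coe_mem_map_closure p hgmem, ?_⟩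
  ext i i'
  fin_cases i <;> fin_cases i' <;>
    simp [coe_mul, coe_S, coe_T_zpow, hg, Matrix.mul_apply, Fin.sum_univ_two]

/-- For `N` prime and `N ∤ j`, under (H_T): `S Tʲ S ∈ K · S T^{j'}` for some integer `j'` (take
`j' = ε pᵏ ≡ −j⁻¹ (mod N)`). -/
theorem exists_S_mul_T_zpow_mul_S_eq [Fact N.Prime]
    (hT : ∀ x : ZMod N, IsUnit x → ∃ k : ℕ, x = (p : ZMod N) ^ k ∨ x = -((p : ZMod N) ^ k))
    {j : ℤ} (hj : ((j : ℤ) : ZMod N) ≠ 0) :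
    ∃ g ∈ (Subgroup.closure (spanGenerators N p)).map (Gamma0 N).subtype, ∃ j' : ℤ,
      S * T ^ j * S = g * (S * T ^ j') := by
  set x : ZMod N := -((j : ℤ) : ZMod N)⁻¹ with hx
  have hxu : IsUnit x := (neg_ne_zero.mpr (inv_ne_zero hj)).isUnit
  obtain ⟨k, hk⟩ := hT x hxu
  -- the integer `j' = ε p^k` with `(j' : ZMod N) = x`
  obtain ⟨j', hj'x, hj'abs⟩ : ∃ j' : ℤ, ((j' : ℤ) : ZMod N) = x ∧ j'.natAbs = p ^ k := by
    rcases hk with hk | hk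
    · exact ⟨(p : ℤ) ^ k, by rw [hk]; push_cast; rfl, by simp [Int.natAbs_pow]⟩
    · exact ⟨-((p : ℤ) ^ k), by rw [hk]; push_cast; rfl, by simp [Int.natAbs_pow]⟩
  have hrel : ((j * j' + 1 : ℤ) : ZMod N) = 0 := by
    push_cast
    rw [hj'x, hx, mul_neg, mul_inv_cancel₀ hj, neg_add_cancel]
  obtain ⟨g, hg, hgj⟩ := exists_S_mul_T_zpow_mul_S_eq_of_rel p j j' hrel hj'abs
  exact ⟨g, hg, j', hgj⟩

/-- **Every matrix is reached** (`N` prime, (H_T)): for every `A ∈ SL(2,ℤ)`, either `A ∈ K` or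
`A = k · (S Tʲ)` with `k ∈ K`, `j ∈ ℤ` — the reached set contains `1` and is stable under right
multiplication by `S^{±1}` and `T^{±1}`, and `SL(2,ℤ) = ⟨S, T⟩` (Mathlib `SL2Z_generators`). -/
theorem mem_or_exists_eq_mul_S_mul_T_zpow [Fact N.Prime]
    (hT : ∀ x : ZMod N, IsUnit x → ∃ k : ℕ, x = (p : ZMod N) ^ k ∨ x = -((p : ZMod N) ^ k))
    (A : SL(2, ℤ)) :
    A ∈ (Subgroup.closure (spanGenerators N p)).map (Gamma0 N).subtype ∨
      ∃ k ∈ (Subgroup.closure (spanGenerators N p)).map (Gamma0 N).subtype, ∃ j : ℤ,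
        A = k * (S * T ^ j) := by
  set K : Subgroup SL(2, ℤ) := (Subgroup.closure (spanGenerators N p)).map (Gamma0 N).subtype with hK
  -- the reached predicate
  let P : SL(2, ℤ) → Prop := fun x ↦ x ∈ K ∨ ∃ k ∈ K, ∃ j : ℤ, x = k * (S * T ^ j)
  -- stability under `T^e`
  have hPT : ∀ x, P x → ∀ e : ℤ, P (x * T ^ e) := by
    rintro x (hx | ⟨k, hk, j, rfl⟩) e
    · exact Or.inl (K.mul_mem hx (K.zpow_mem (T_mem_map_closure p) e))
    · refine Or.inr ⟨k, hk, j + e, ?_⟩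
      rw [_root_.zpow_add]
      group
  -- stability under `S`
  have hPS : ∀ x, P x → P (x * S) := by
    rintro x (hx | ⟨k, hk, j, rfl⟩)
    · exact Or.inr ⟨x, hx, 0, by simp⟩
    · by_cases hj : ((j : ℤ) : ZMod N) = 0
      · refine Or.inl ?_
        have : k * (S * T ^ j) * S = k * (S * T ^ j * S) := by group
        rw [this]
        exact K.mul_mem hk (S_mul_T_zpow_mul_S_mem_of_dvd p hj)
      · obtain ⟨g, hg, j', hgj⟩ := exists_S_mul_T_zpow_mul_S_eq p hT hj
        refine Or.inr ⟨k * g, K.mul_mem hk hg, j', ?_⟩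
        have : k * (S * T ^ j) * S = k * (S * T ^ j * S) := by group
        rw [this, hgj, mul_assoc]
  -- two-sided stability along `⟨S, T⟩`
  have key : ∀ g ∈ Subgroup.closure ({S, T} : Set SL(2, ℤ)),
      (∀ x, P x → P (x * g)) ∧ (∀ x, P x → P (x * g⁻¹)) := by
    intro g hg
    induction hg using Subgroup.closure_induction with
    | mem g hg =>
      rcases hg with rfl | rfl
      · -- `g = S`, `S⁻¹ = S³`
        refine ⟨fun x hx ↦ hPS x hx, fun x hx ↦ ?_⟩
        have hS3 : S⁻¹ = S * S * S := by
          rw [inv_eq_iff_mul_eq_one]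
          ext i j
          fin_cases i <;> fin_cases j <;> simp [coe_mul, coe_S, Matrix.mul_apply, Fin.sum_univ_two]
        rw [hS3, ← mul_assoc, ← mul_assoc]
        exact hPS _ (hPS _ (hPS _ hx))
      · -- `g = T`
        refine ⟨fun x hx ↦ ?_, fun x hx ↦ ?_⟩
        · simpa using hPT x hx 1
        · simpa using hPT x hx (-1)
    | one =>
      exact ⟨fun x hx ↦ by rw [mul_one]; exact hx, fun x hx ↦ by rw [inv_one, mul_one]; exact hx⟩
    | mul g h _ _ ihg ihh =>
      refine ⟨fun x hx ↦ ?_, fun x hx ↦ ?_⟩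
      · rw [← mul_assoc]; exact ihh.1 _ (ihg.1 _ hx)
      · rw [_root_.mul_inv_rev, ← mul_assoc]; exact ihg.2 _ (ihh.2 _ hx)
    | inv g _ ih => exact ⟨ih.2, fun x hx ↦ by simpa using ih.1 x hx⟩
  have h1 : P 1 := Or.inl K.one_mem
  have hA : A ∈ Subgroup.closure ({S, T} : Set SL(2, ℤ)) := by
    rw [SpecialLinearGroup.SL2Z_generators]; exact Subgroup.mem_top A
  simpa [P] using (key A hA).1 1 h1

/-- **THEOREM (T)** (generation form).  For `N` prime and `p` with `(ℤ/N)ˣ = ⟨−1, p⟩` (every unit of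
`ℤ/N` is `±pᵏ`), the good, finite-order and trace-`±2` elements generate `Γ₀(N)`:
`Subgroup.closure (spanGenerators N p) = ⊤` (bsd-f3-mu MEMO-an §10.2 THEOREM (T); cell memo
LINE-VERTICAL-STEVENS-AT-3 §3). -/
theorem closure_spanGenerators_eq_top [Fact N.Prime]
    (hT : ∀ x : ZMod N, IsUnit x → ∃ k : ℕ, x = (p : ZMod N) ^ k ∨ x = -((p : ZMod N) ^ k)) :
    Subgroup.closure (spanGenerators N p) = ⊤ := by
  rw [eq_top_iff]
  intro γ _
  rcases mem_or_exists_eq_mul_S_mul_T_zpow p hT (γ : SL(2, ℤ)) with h | ⟨k, hk, j, hγ⟩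
  · exact mem_closure_of_coe_mem_map p h
  · exfalso
    -- `S Tʲ = k⁻¹ γ ∈ Γ₀(N)` forces `N ∣ 1`
    have hmem : S * T ^ j ∈ Gamma0 N := by
      have : S * T ^ j = k⁻¹ * (γ : SL(2, ℤ)) := by rw [hγ]; group
      rw [this]
      exact (Gamma0 N).mul_mem ((Gamma0 N).inv_mem (mem_gamma0_of_mem_map p hk)) γ.2
    rw [Gamma0_mem] at hmem
    have h10 : ((S * T ^ j : SL(2, ℤ)) : Matrix (Fin 2) (Fin 2) ℤ) 1 0 = 1 := by
      simp [coe_mul, coe_S, coe_T_zpow, Matrix.mul_apply, Fin.sum_univ_two]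
    rw [h10, Int.cast_one] at hmem
    exact one_ne_zero hmem

/-- **THEOREM (T)**, span form: under the same hypotheses `spanSubgroup N p = ⊤`
(`spanSubgroup = closure ⊔ commutator`). -/
theorem spanSubgroup_eq_top [Fact N.Prime]
    (hT : ∀ x : ZMod N, IsUnit x → ∃ k : ℕ, x = (p : ZMod N) ^ k ∨ x = -((p : ZMod N) ^ k)) :
    spanSubgroup N p = ⊤ :=
  top_le_iff.mp ((closure_spanGenerators_eq_top p hT).symm.le.trans (closure_le_spanSubgroup N p))

/-- **THEOREM (T) ⟹ CONJ-SPAN(N,p)** at prime level `N` with `(ℤ/N)ˣ = ⟨−1,p⟩`: `ConjSpanGen N p`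
(through Manin 1972 Prop. 1.4: `V(N,p) = H₁(X₀(N);ℤ)`, MEMO-an §10.2). -/
theorem conjSpanGen_of_prime [Fact N.Prime]
    (hT : ∀ x : ZMod N, IsUnit x → ∃ k : ℕ, x = (p : ZMod N) ^ k ∨ x = -((p : ZMod N) ^ k)) :
    ConjSpanGen N p :=
  conjSpanGen_of_spanSubgroup_eq_top (spanSubgroup_eq_top p hT)

/-- **THEOREM (T) ⟹ EIS-SPAN(N,p)** at prime level `N` with `(ℤ/N)ˣ = ⟨−1,p⟩` (`p ≠ 1`). -/
theorem eisSpanGen_of_prime [Fact N.Prime] (hp : p ≠ 1)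
    (hT : ∀ x : ZMod N, IsUnit x → ∃ k : ℕ, x = (p : ZMod N) ^ k ∨ x = -((p : ZMod N) ^ k)) :
    EisSpanGen N p :=
  eisSpanGen_of_conjSpanGen hp (conjSpanGen_of_prime p hT)

/-- `(ℤ/11)ˣ = ⟨−1, 3⟩`, as a finite check: every residue mod `11` is `0` or `±3ᵏ` with `k < 5`
(`⟨3⟩ = {1, 3, 9, 5, 4}`, `−⟨3⟩ = {10, 8, 2, 6, 7}`). -/
theorem zmod_eleven_eq_zero_or_pow_three :
    ∀ y : ZMod 11, y = 0 ∨ ∃ k : Fin 5, y = 3 ^ (k : ℕ) ∨ y = -(3 ^ (k : ℕ)) := by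
  decide

/-- Non-vacuity / first certified level of VS-0 in the kernel: **CONJ-SPAN(11, 3)** — every closed class
on `X₀(11)` is a sum of `3`-power winding classes (kit j286420 line `N=11 p=3 l=3: … [FULL]`, now a
theorem; `11a` is `3`-ordinary with `a₃ = −1`, not an X8 level — the instance exercises THEOREM (T)). -/
theorem conjSpanGen_eleven_three : ConjSpanGen 11 3 := by
  haveI : Fact (Nat.Prime 11) := ⟨by norm_num⟩
  refine conjSpanGen_of_prime 3 fun x hx ↦ ?_
  rcases zmod_eleven_eq_zero_or_pow_three x with h0 | ⟨k, hk⟩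
  · exact (hx.ne_zero h0).elim
  · exact ⟨k, by exact_mod_cast hk⟩

end TheoremT

end Summit.BirchSwinnertonDyer.BirchSwinnertonDyer.Theorems.PrintX8VerticalStevens
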